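import Summits.NavierStokesRegularity.NavierStokesRegularity.Theorems.FrequencyRigidity.Negative.SelfSimilarSwirl
import Literature.Analysis.FluidPDE.HyperbolicDSSOrbit

/-!
# `FrequencyRigidity` (crux `stmt-NavierStokesRegularity-2955`, route `AdaptedFrequency`):
# (R) the breathing two-shell swirl — OBJECTS and PROFILE CALCULUS (file 1 of 4 of series (R))

`AdaptedFrequency.FrequencyRigidity = ¬ ∃ (ν C Λ₀ v q K), …`: no smooth ancient Navier–Stokes
flow on `ℝ³ × (−∞,0)` with the GLOBAL Type-I bound, an adapted two-sided Gaussian-comparable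
kernel `K` at `(0,0)`, positive adapted enstrophy `H` and constant adapted frequency `Λ ≡ Λ₀`.
No `¬`-theorem of the crux is claimed (a witness contains a non-trivial bounded ancient mild
solution with two-ended Type-I decay — open; see `Cruxes/FrequencyRigidity/Disproof.lean`).
Series (R) of the negative-side support files (after `Clauses`, `RigidRotation`,
`FrequencyStructure`, `SelfSimilarSwirl`, `SmallLocalTypeI`) refutes the INFERENCE "constant
adapted frequency ⇒ (rotated) self-similar" at the level of everything except the momentum
equation, by ONE explicit field, the BREATHING TWO-SHELL SWIRL
`breath ν t x = (−t)^{−1/2} W_t(x/√(−t))`, `W_t = a(t)V + b(t)V₂`, `a = √A₂ cos log(−t)`,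
`b = √A₁ sin log(−t)`, inner profile `V = χ·(e₃ × ·)` (support `‖y‖² ≤ 2`), outer profile
`V₂ = ψ·(e₃ × ·)` (support `3 ≤ ‖y‖² ≤ 8`), `Aᵢ` the Gaussian enstrophies of the two profiles:
smooth, divergence-free, GLOBAL Type-I, heat kernel adapted, `H(t) = A₁A₂/t²` EXACTLY (`Λ ≡ 2`),
centred, scale-invariant bounds, steady/covariant/slaved kernel — yet NOT backward self-similar
(it is `e^{π}`-DSS and the half-turn dilation flips its sign) and NOT a rotating wave
`pvAnsatz α U₀` for any `α`.  Files: `BreathingSwirlObjects` (all definitions,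
profile calculus), `BreathingSwirl` (kinematics, `H = A₁A₂/t²`, `Λ ≡ 2`), `BreathingSwirlNonRigid`
((R1) not self-similar, (R2) not a rotating wave), `BreathingSwirlNormalForm` ((R3) the normal-form
clauses of line `kernel-fading-memory` hold kinematically; `kinematic_canonical_witness`).

This file holds every DEFINITION of series (R): the outer radial cutoff `ψ` and
profile `V₂`, its Gaussian enstrophy density `F₂`, the amplitudes `amp₁ = a`, `amp₂ = b`, the
breathing profile `Wb = W_t`, the field `breath`, its profile enstrophy density `Fb`, the Type-I
constant `Cb`, two test points `y₀` (outer shell) and `y₁` (inner ball), the predicate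
`IsBackwardSelfSimilar`, and — verbatim from `Cruxes/FrequencyRigidity/Lines/kernel-fading-memory.lean`
(namespace `…Cruxes.FrequencyRigidity.KernelFadingMemory`, restated because a `Theorems/` file
cannot import a skeleton) — the normal-form vocabulary `IsCentred`, `HasScaleInvariantBounds`,
`simKernel`, `IsSymmetryCovariant`, `IsSlaved`; and the PROFILE CALCULUS: `ψ` is smooth, radial
(`Dψ(e₃ × y) = 0`), `0 ≤ ψ ≤ 1`, `ψ = 0` on `‖y‖² ≤ 3` and on `‖y‖² ≥ 8`, `ψ = 1` on
`4 ≤ ‖y‖² ≤ 7`; `V₂ = ψ·rot` is smooth, compactly supported, bounded by `3`, tangent to the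
spheres, divergence-free; curl bookkeeping on the DISJOINT supports (`curl V₂ = 0` on `‖y‖² < 3`,
`curl V = 0` on `‖y‖² > 2`, `curl V₂(y₀) = 2e₃`); `W_t = aV + bV₂`: `curl W_t = a curl V + b curl V₂`,
the pointwise Pythagoras `‖curl W_t‖² = a²‖curl V‖² + b²‖curl V₂‖²`, divergence-free,
`‖W_t‖ ≤ 2|a| + 3|b|`, tangent to the spheres, odd.

## References

* B. Pineau, V. Vicol, arXiv:2607.09619 (2026), (1.7), Conj. 1.1, Thm 1.4. [PineauVicol2026]
* Z. Bradshaw, T.-P. Tsai, Comm. PDE 42 (2017), §5 OP 5.1–5.2. [BradshawTsai2017CPDE]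
* D. Chae, J. Wolf, arXiv:1610.09464, Thm 1.3. [ChaeWolf2017RemovingDSS]
* T.-P. Tsai, Arch. Ration. Mech. Anal. 143 (1998) 29–51, Thm 1. [Tsai1998]
* G. Koch, N. Nadirashvili, G. Seregin, V. Šverák, Acta Math. 203 (2009) 83–105.
  [KochNadirashviliSereginSverak2009]
-/

noncomputable section

set_option linter.dupNamespace false

namespace Summit.NavierStokesRegularity.NavierStokesRegularity.Theorems.FrequencyRigidity.Negative

open Literature.Analysis.FluidPDE Literature.Analysis.UnboundedOperators
open MeasureTheory Set Filter Topology Function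
open scoped Laplacian InnerProductSpace RealInnerProductSpace ContDiff

/-! ### Profiles, amplitudes, the breathing swirl -/

/-- Outer radial cutoff `ψ y = smoothTransition (‖y‖² − 3) · smoothTransition (8 − ‖y‖²)`:
smooth, radial, supported in the shell `3 ≤ ‖y‖² ≤ 8`, equal to `1` on `4 ≤ ‖y‖² ≤ 7`. -/
def ψ (y : E3) : ℝ := Real.smoothTransition (‖y‖ ^ 2 - 3) * Real.smoothTransition (8 - ‖y‖ ^ 2)

/-- The OUTER swirl profile `V₂ y = ψ(y) · (e₃ × y)`: smooth, supported in the shell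
`3 ≤ ‖y‖² ≤ 8` (disjoint from the support `‖y‖² ≤ 2` of the inner profile `V`),
divergence-free, tangent to the spheres about `0`, equal to `e₃ × y` on `4 ≤ ‖y‖² ≤ 7`. -/
def V₂ (y : E3) : E3 := ψ y • rot y

/-- The outer profile enstrophy density against the Gaussian `G_ν`. -/
def F₂ (ν : ℝ) (y : E3) : ℝ := ‖curl V₂ y‖ ^ 2 * heatKernel ν y

/-- Inner amplitude `a(t) = √A₂ · cos (log (−t))`, `A₂ = ∫ F₂`. -/
def amp₁ (ν t : ℝ) : ℝ := Real.sqrt (∫ y, F₂ ν y) * Real.cos (Real.log (-t))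

/-- Outer amplitude `b(t) = √A₁ · sin (log (−t))`, `A₁ = ∫ F`. -/
def amp₂ (ν t : ℝ) : ℝ := Real.sqrt (∫ y, F ν y) * Real.sin (Real.log (-t))

/-- The BREATHING PROFILE at time `t`: `W_t = a(t) V + b(t) V₂` — enstrophy is exchanged
`log`-periodically between the inner ball and the outer shell. -/
def Wb (ν t : ℝ) (y : E3) : E3 := amp₁ ν t • V y + amp₂ ν t • V₂ y

/-- **The breathing swirl** `breath ν t x = (−t)^{−1/2} W_t (x/√(−t))`. -/
def breath (ν t : ℝ) (x : E3) : E3 := sc t • Wb ν t (sc t • x)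

/-- The breathing profile enstrophy density `‖curl W_t‖² G_ν`. -/
def Fb (ν t : ℝ) (y : E3) : ℝ := ‖curl (Wb ν t) y‖ ^ 2 * heatKernel ν y

/-! ### Test points, Type-I constant, self-similarity -/

/-- The test point `y₀ = (5/2) e₁` in the shell where `V₂ = rot`. -/
def y₀ : E3 := EuclideanSpace.single 0 (5 / 2)

/-- The Type-I constant of the breathing swirl, `C_b = 2√A₂ + 3√A₁`. -/
def Cb (ν : ℝ) : ℝ := 2 * Real.sqrt (∫ y, F₂ ν y) + 3 * Real.sqrt (∫ y, F ν y)

/-- Backward self-similarity about `(0,0)`: invariance under every parabolic dilation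
`v ↦ l v(l²t, l x)`, `l > 0` (Leray's backward ansatz, `pvAnsatz 0 U₀`). -/
def IsBackwardSelfSimilar (v : ℝ → E3 → E3) : Prop :=
  ∀ l : ℝ, 0 < l → ∀ t ∈ Iio (0:ℝ), ∀ x, l • v (l ^ 2 * t) (l • x) = v t x

/-- The test point `y₁ = ½ e₁` in the inner ball where `V = rot`. -/
def y₁ : E3 := EuclideanSpace.single 0 (1 / 2)

/-! ### Normal-form vocabulary of line `kernel-fading-memory` (verbatim) -/

/-- **Centred gauge** (verbatim `KernelFadingMemory.IsCentred`): `∫ xK = 0` and `∫ vK = 0`. -/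
def IsCentred (v : ℝ → E3 → E3) (K : ℝ → E3 → ℝ) : Prop :=
  (∀ t ∈ Iio (0:ℝ), (∫ x, K t x • x) = (0 : E3)) ∧
    (∀ t ∈ Iio (0:ℝ), (∫ x, K t x • v t x) = (0 : E3))

/-- **Scale-invariant first-order bounds** (verbatim `KernelFadingMemory.HasScaleInvariantBounds`). -/
def HasScaleInvariantBounds (C' : ℝ) (v : ℝ → E3 → E3) : Prop :=
  ∀ t ∈ Iio (0:ℝ), ∀ x, ‖fderiv ℝ (v t) x‖ ≤ C' / (-t) ∧ ‖curl (v t) x‖ ≤ C' / (-t) ∧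
    ‖timeDerivWithin (Iio (0:ℝ)) v t x‖ ≤ C' * (-t) ^ (-(3:ℝ) / 2)

/-- **Rescaled kernel in backward similarity variables** (verbatim `KernelFadingMemory.simKernel`):
`K̃(s,y) = e^{−3s/2} K(−e^{−s}, e^{−s/2}y)`. -/
def simKernel (K : ℝ → E3 → ℝ) (s : ℝ) (y : E3) : ℝ :=
  Real.exp (-(3:ℝ) / 2 * s) * K (-Real.exp (-s)) (Real.exp (-s / 2) • y)

/-- **Symmetry inheritance** (verbatim `KernelFadingMemory.IsSymmetryCovariant`). -/
def IsSymmetryCovariant (v : ℝ → E3 → E3) (K : ℝ → E3 → ℝ) : Prop :=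
  ∀ (c : ℝ) (R : E3 ≃ₗᵢ[ℝ] E3), 0 < c →
    (∀ t ∈ Iio (0:ℝ), ∀ x, c • R.symm (v (c ^ 2 * t) (c • R x)) = v t x) →
      ∀ t ∈ Iio (0:ℝ), ∀ x, K t x = c ^ 3 * K (c ^ 2 * t) (c • R x)

/-- **Slaving (fading memory)** (verbatim `KernelFadingMemory.IsSlaved`). -/
def IsSlaved (κ M : ℝ) (v : ℝ → E3 → E3) (K : ℝ → E3 → ℝ) : Prop :=
  ∀ s : ℝ,
    (∫ y, |deriv (fun s' => simKernel K s' y) s|) ≤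
      M * ∫ τ in Ioi (0:ℝ), Real.exp (-κ * τ) *
        ∫ y, ‖deriv (fun s' => lerayOrbit v s' y) (s + τ)‖ * (1 + ‖y‖ ^ 2) ^ 2 * simKernel K (s + τ) y

/-! ## Profile calculus -/


/-! ### The outer cutoff and profile -/

/-- The outer cutoff is smooth. -/
theorem ψ_contDiff {n : ℕ∞} : ContDiff ℝ n ψ :=
  (Real.smoothTransition.contDiff.comp ((contDiff_norm_sq ℝ).sub contDiff_const)).mul
    (Real.smoothTransition.contDiff.comp (contDiff_const.sub (contDiff_norm_sq ℝ)))

/-- The outer cutoff is nonnegative. -/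
theorem ψ_nonneg (y : E3) : 0 ≤ ψ y :=
  mul_nonneg (Real.smoothTransition.nonneg _) (Real.smoothTransition.nonneg _)

/-- The outer cutoff is at most `1`. -/
theorem ψ_le_one (y : E3) : ψ y ≤ 1 :=
  mul_le_one₀ (Real.smoothTransition.le_one _) (Real.smoothTransition.nonneg _)
    (Real.smoothTransition.le_one _)

/-- The outer cutoff vanishes on `‖y‖² ≤ 3`. -/
theorem ψ_eq_zero_of_le {y : E3} (hy : ‖y‖ ^ 2 ≤ 3) : ψ y = 0 := by
  rw [ψ, Real.smoothTransition.zero_of_nonpos (by linarith), zero_mul]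

/-- The outer cutoff vanishes on `‖y‖² ≥ 8`. -/
theorem ψ_eq_zero_of_ge {y : E3} (hy : 8 ≤ ‖y‖ ^ 2) : ψ y = 0 := by
  rw [ψ, Real.smoothTransition.zero_of_nonpos (x := 8 - ‖y‖ ^ 2) (by linarith), mul_zero]

/-- The outer cutoff is `1` on `4 ≤ ‖y‖² ≤ 7`. -/
theorem ψ_eq_one {y : E3} (h1 : 4 ≤ ‖y‖ ^ 2) (h2 : ‖y‖ ^ 2 ≤ 7) : ψ y = 1 := by
  rw [ψ, Real.smoothTransition.one_of_one_le (by linarith),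
    Real.smoothTransition.one_of_one_le (by linarith), mul_one]

/-- The outer cutoff is radial: its derivative kills the rotation field. -/
theorem fderiv_ψ_rot (y : E3) : fderiv ℝ ψ y (rot y) = 0 := by
  have hn : HasFDerivAt (fun y : E3 => ‖y‖ ^ 2) ((2:ℕ) • innerSL ℝ y) y :=
    (hasStrictFDerivAt_norm_sq y).hasFDerivAt
  have h1 : HasFDerivAt (fun y : E3 => ‖y‖ ^ 2 - 3) ((2:ℕ) • innerSL ℝ y) y := hn.sub_const 3
  have h2 : HasFDerivAt (fun y : E3 => 8 - ‖y‖ ^ 2) (-((2:ℕ) • innerSL ℝ y)) y := by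
    simpa using hn.const_sub (8:ℝ)
  have hs : ∀ r : ℝ, HasDerivAt Real.smoothTransition (deriv Real.smoothTransition r) r := fun r =>
    ((Real.smoothTransition.contDiff (n := 1)).differentiable (by simp) _).hasDerivAt
  have hA := (hs _).comp_hasFDerivAt y h1
  have hB := (hs _).comp_hasFDerivAt y h2
  have h := (hA.mul hB).fderiv
  have hψ : ((Real.smoothTransition ∘ fun y : E3 => ‖y‖ ^ 2 - 3) *
      (Real.smoothTransition ∘ fun y : E3 => 8 - ‖y‖ ^ 2)) = ψ := by
    funext z; rfl
  rw [hψ] at h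
  rw [h]
  simp [inner_self_rot]

/-- The outer profile is smooth. -/
theorem V₂_contDiff {n : ℕ∞} : ContDiff ℝ n V₂ := ψ_contDiff.smul rot.contDiff

/-- The outer profile vanishes on `‖y‖² ≤ 3`. -/
theorem V₂_eq_zero_of_le {y : E3} (hy : ‖y‖ ^ 2 ≤ 3) : V₂ y = 0 := by
  simp [V₂, ψ_eq_zero_of_le hy]

/-- The outer profile vanishes on `‖y‖² ≥ 8`. -/
theorem V₂_eq_zero_of_ge {y : E3} (hy : 8 ≤ ‖y‖ ^ 2) : V₂ y = 0 := by
  simp [V₂, ψ_eq_zero_of_ge hy]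

/-- The outer profile IS rigid rotation on `4 ≤ ‖y‖² ≤ 7`. -/
theorem V₂_eq_rot {y : E3} (h1 : 4 ≤ ‖y‖ ^ 2) (h2 : ‖y‖ ^ 2 ≤ 7) : V₂ y = rot y := by
  simp [V₂, ψ_eq_one h1 h2]

/-- The outer profile has compact support (in the closed ball of radius `3`). -/
theorem hasCompactSupport_V₂ : HasCompactSupport V₂ := by
  refine HasCompactSupport.intro (isCompact_closedBall (0:E3) 3) fun y hy => V₂_eq_zero_of_ge ?_
  have h3 : 3 < ‖y‖ := by simpa [dist_eq_norm] using hy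
  nlinarith

/-- The outer profile is bounded by `3`. -/
theorem norm_V₂_le (y : E3) : ‖V₂ y‖ ≤ 3 := by
  by_cases hy : 8 ≤ ‖y‖ ^ 2
  · simp [V₂_eq_zero_of_ge hy]
  · have h1 : ‖y‖ ≤ 3 := by nlinarith [norm_nonneg y]
    calc ‖V₂ y‖ = ψ y * ‖rot y‖ := by rw [V₂, norm_smul, Real.norm_of_nonneg (ψ_nonneg y)]
      _ ≤ 1 * ‖y‖ := mul_le_mul (ψ_le_one y) (norm_rot_le y) (norm_nonneg _) zero_le_one
      _ ≤ 3 := by linarith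

/-- The outer profile is tangent to the spheres about the origin. -/
theorem inner_self_V₂ (y : E3) : ⟪y, V₂ y⟫ = 0 := by
  rw [V₂, inner_smul_right, inner_self_rot, mul_zero]

/-- Product rule for the outer profile. -/
theorem hasFDerivAt_V₂ (y : E3) :
    HasFDerivAt V₂ (ψ y • rot + (fderiv ℝ ψ y).smulRight (rot y)) y :=
  ((ψ_contDiff (n := 1)).differentiable (by simp) y).hasFDerivAt.smul rot.hasFDerivAt

/-- The outer profile is divergence-free: `div (ψ rot) = ψ tr(rot) + Dψ(rot y) = 0 + 0`. -/
theorem divergence_V₂ (y : E3) : VectorCalculus.divergence V₂ y = 0 := by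
  rw [VectorCalculus.divergence, (hasFDerivAt_V₂ y).fderiv, ContinuousLinearMap.toLinearMap_add,
    map_add, ContinuousLinearMap.toLinearMap_smul, map_smul, trace_rot, smul_zero, zero_add]
  rw [show ((fderiv ℝ ψ y).smulRight (rot y) : E3 →ₗ[ℝ] E3) =
      ((fderiv ℝ ψ y : E3 →L[ℝ] ℝ) : E3 →ₗ[ℝ] ℝ).smulRight (rot y) from rfl,
    LinearMap.trace_smulRight]
  exact fderiv_ψ_rot y

/-! ### Curl bookkeeping: disjoint supports -/

/-- `curl` only depends on the germ of the field. -/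
theorem curl_congr_eventuallyEq {W₁ W₂ : E3 → E3} {y : E3} (h : W₁ =ᶠ[𝓝 y] W₂) :
    curl W₁ y = curl W₂ y := by
  simp only [curl, h.fderiv_eq]

/-- The outer profile vanishes near every point of the open ball `‖y‖² < 3`. -/
theorem V₂_eventuallyEq_zero {y : E3} (hy : ‖y‖ ^ 2 < 3) : V₂ =ᶠ[𝓝 y] fun _ => 0 := by
  have ho : IsOpen {z : E3 | ‖z‖ ^ 2 < 3} := isOpen_lt (continuous_norm.pow 2) continuous_const
  filter_upwards [ho.mem_nhds hy] with z hz
  exact V₂_eq_zero_of_le (le_of_lt hz)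

/-- The inner profile vanishes near every point of the open exterior `‖y‖² > 2`. -/
theorem V_eventuallyEq_zero {y : E3} (hy : 2 < ‖y‖ ^ 2) : V =ᶠ[𝓝 y] fun _ => 0 := by
  have ho : IsOpen {z : E3 | 2 < ‖z‖ ^ 2} := isOpen_lt continuous_const (continuous_norm.pow 2)
  filter_upwards [ho.mem_nhds hy] with z hz
  exact V_eq_zero (le_of_lt hz)

/-- The outer profile IS rigid rotation near every point of the open shell `4 < ‖y‖² < 7`. -/
theorem V₂_eventuallyEq_rot {y : E3} (h1 : 4 < ‖y‖ ^ 2) (h2 : ‖y‖ ^ 2 < 7) :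
    V₂ =ᶠ[𝓝 y] (⇑rot) := by
  have ho : IsOpen {z : E3 | 4 < ‖z‖ ^ 2 ∧ ‖z‖ ^ 2 < 7} :=
    (isOpen_lt continuous_const (continuous_norm.pow 2)).inter
      (isOpen_lt (continuous_norm.pow 2) continuous_const)
  filter_upwards [ho.mem_nhds ⟨h1, h2⟩] with z hz
  exact V₂_eq_rot hz.1.le hz.2.le

/-- The outer vorticity vanishes on the open ball `‖y‖² < 3`. -/
theorem curl_V₂_eq_zero {y : E3} (hy : ‖y‖ ^ 2 < 3) : curl V₂ y = 0 := by
  rw [curl_congr_eventuallyEq (V₂_eventuallyEq_zero hy), curl_const]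

/-- The inner vorticity vanishes on the open exterior `‖y‖² > 2`. -/
theorem curl_V_eq_zero {y : E3} (hy : 2 < ‖y‖ ^ 2) : curl V y = 0 := by
  rw [curl_congr_eventuallyEq (V_eventuallyEq_zero hy), curl_const]

/-- `‖y₀‖² = 25/4`. -/
theorem norm_y₀_sq : ‖y₀‖ ^ 2 = 25 / 4 := by
  rw [y₀, PiLp.norm_single, Real.norm_eq_abs, abs_of_pos (by norm_num)]
  norm_num

/-- At `y₀` the outer vorticity is `2e₃`. -/
theorem curl_V₂_y₀ : curl V₂ y₀ = (2:ℝ) • e₃ := by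
  rw [curl_congr_eventuallyEq (V₂_eventuallyEq_rot (y := y₀) (by rw [norm_y₀_sq]; norm_num)
    (by rw [norm_y₀_sq]; norm_num)), curl_rot]

/-! ### The breathing profile: derivative, curl, divergence -/

/-- Derivative of the breathing profile. -/
theorem hasFDerivAt_Wb (ν t : ℝ) (y : E3) :
    HasFDerivAt (Wb ν t) (amp₁ ν t • (χ y • rot + (fderiv ℝ χ y).smulRight (rot y)) +
      amp₂ ν t • (ψ y • rot + (fderiv ℝ ψ y).smulRight (rot y))) y := by
  have h : Wb ν t = amp₁ ν t • V + amp₂ ν t • V₂ := by funext z; rfl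
  rw [h]
  exact ((hasFDerivAt_V y).const_smul _).add ((hasFDerivAt_V₂ y).const_smul _)

/-- The breathing profile is smooth in space. -/
theorem Wb_contDiff (ν t : ℝ) {n : ℕ∞} : ContDiff ℝ n (Wb ν t) := by
  show ContDiff ℝ n (fun y => amp₁ ν t • V y + amp₂ ν t • V₂ y)
  exact (V_contDiff.const_smul _).add (V₂_contDiff.const_smul _)

/-- `curl W_t = a(t) curl V + b(t) curl V₂`. -/
theorem curl_Wb (ν t : ℝ) (y : E3) :
    curl (Wb ν t) y = amp₁ ν t • curl V y + amp₂ ν t • curl V₂ y := by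
  simp only [curl, (hasFDerivAt_Wb ν t y).fderiv, (hasFDerivAt_V y).fderiv, (hasFDerivAt_V₂ y).fderiv]
  ext i
  fin_cases i <;> simp [mul_sub] <;> ring

/-- Pointwise Pythagoras (disjoint supports): `‖curl W_t‖² = a² ‖curl V‖² + b² ‖curl V₂‖²`. -/
theorem norm_curl_Wb_sq (ν t : ℝ) (y : E3) :
    ‖curl (Wb ν t) y‖ ^ 2 = amp₁ ν t ^ 2 * ‖curl V y‖ ^ 2 + amp₂ ν t ^ 2 * ‖curl V₂ y‖ ^ 2 := by
  rw [curl_Wb]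
  rcases lt_or_ge (‖y‖ ^ 2) 3 with h | h
  · rw [curl_V₂_eq_zero h]
    simp [norm_smul, mul_pow]
  · rw [curl_V_eq_zero (by linarith)]
    simp [norm_smul, mul_pow]

/-- The breathing profile is divergence-free. -/
theorem divergence_Wb (ν t : ℝ) (y : E3) : VectorCalculus.divergence (Wb ν t) y = 0 := by
  have h1 := divergence_V y
  have h2 := divergence_V₂ y
  rw [VectorCalculus.divergence, (hasFDerivAt_V y).fderiv] at h1
  rw [VectorCalculus.divergence, (hasFDerivAt_V₂ y).fderiv] at h2
  rw [VectorCalculus.divergence, (hasFDerivAt_Wb ν t y).fderiv, ContinuousLinearMap.toLinearMap_add,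
    map_add, ContinuousLinearMap.toLinearMap_smul, map_smul, ContinuousLinearMap.toLinearMap_smul,
    map_smul, h1, h2, smul_zero, smul_zero, add_zero]

/-- The breathing profile is bounded: `‖W_t y‖ ≤ 2|a(t)| + 3|b(t)|`. -/
theorem norm_Wb_le (ν t : ℝ) (y : E3) : ‖Wb ν t y‖ ≤ 2 * |amp₁ ν t| + 3 * |amp₂ ν t| := by
  calc ‖Wb ν t y‖ ≤ ‖amp₁ ν t • V y‖ + ‖amp₂ ν t • V₂ y‖ := norm_add_le _ _
    _ = |amp₁ ν t| * ‖V y‖ + |amp₂ ν t| * ‖V₂ y‖ := by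
        rw [norm_smul, norm_smul, Real.norm_eq_abs, Real.norm_eq_abs]
    _ ≤ |amp₁ ν t| * 2 + |amp₂ ν t| * 3 :=
        add_le_add (mul_le_mul_of_nonneg_left (norm_V_le y) (abs_nonneg _))
          (mul_le_mul_of_nonneg_left (norm_V₂_le y) (abs_nonneg _))
    _ = 2 * |amp₁ ν t| + 3 * |amp₂ ν t| := by ring

/-- The breathing profile is tangent to the spheres about the origin. -/
theorem inner_self_Wb (ν t : ℝ) (y : E3) : ⟪y, Wb ν t y⟫ = 0 := by
  rw [Wb, inner_add_right, inner_smul_right, inner_smul_right, inner_self_V, inner_self_V₂]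
  ring

/-- The breathing profile is odd. -/
theorem Wb_neg (ν t : ℝ) (y : E3) : Wb ν t (-y) = -Wb ν t y := by
  have hχ : χ (-y) = χ y := by simp [χ, norm_neg]
  have hψ : ψ (-y) = ψ y := by simp [ψ, norm_neg]
  simp only [Wb, V, V₂, hχ, hψ, map_neg, smul_neg, neg_add]

end Summit.NavierStokesRegularity.NavierStokesRegularity.Theorems.FrequencyRigidity.Negative
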